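import Summits.AtomisticToContinuum.FouriersLaw.Theses.HonestZwanzig
import Summits.AtomisticToContinuum.FouriersLaw.Theorems.HonestZwanzigNetworkReductionPackage
import Summits.AtomisticToContinuum.FouriersLaw.Theorems.HonestZwanzigRobinCoercivityStubFeshbachIdentities
import Summits.AtomisticToContinuum.FouriersLaw.Theorems.HonestZwanzigOrthogonalOhmFixedNLimits
import Summits.AtomisticToContinuum.FouriersLaw.Theorems.HonestZwanzigOrthogonalOhmG0PosDef

/-!
# HonestZwanzig / OrthogonalOhm — the crux reduced to its N-uniform core (line `Sketch`, skeleton v6 made citable)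

Support file for crux item `stmt-AtomisticToContinuum-12693` (`HonestZwanzig.OrthogonalOhm`, sub-problem `FouriersLaw`).

Every FIXED-`N` ingredient of the crux is proved in the tree: the zero-frequency energy Gram matrix is positive
definite (`stub_G0PosDef`, p144152; independently `g0PosDef_of_stubs` of the skeleton from the landed F1a/F1b/F2/F3),
and the Schur pairings of admissible observables are right-continuous at `s = 0` when `det G(0)` is a unit
(`stub_fixedNLimits`, p140890).  Hence the `s ↓ 0` limits in BOTH clauses of `OrthogonalOhm` exist at every `N` and
equal the `s = 0` gadgets, and the crux FOLLOWS from — indeed is equivalent, modulo these fixed-`N` facts, to — the two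
`N`-UNIFORM bound statements spelled out as hypotheses below (they are the registered open stubs
`stub_uniformBondResponse` (U1) and `stub_uniformContactResponse` (U2) of line `Sketch`, verbatim):

* `orthogonalOhm_of_uniformResponses : U1 → U2 → OrthogonalOhm`.

U1 ⊇ `HasBoundedResponse (pinnedChain …)` (disprover: `conductance_le_of_rowConstancy_backflow_bound`); U2 reduces to
U1 at the two end bonds plus an endpoint bound on the energy shadow of the current
(`uniformContactResponse_of_endBond_of_shadow`, p141498).  This is the honest open core of the crux (limiting absorption
at zero frequency for the orthogonal dynamics, uniformly in `N`).
-/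

namespace Summit.AtomisticToContinuum.FouriersLaw.Theorems.HonestZwanzig

open MeasureTheory Filter Topology
open Literature.MathematicalPhysics.KineticTheory.HeatConduction
open Summit.AtomisticToContinuum.FouriersLaw.Theorems.HonestZwanzig.NetworkReduction

/-- **OrthogonalOhm from its N-uniform core.**  If (U1) there are `k, C` such that for every `ε > 0` there is `R`
with: for all `N ≥ 2` and every bond `b`, ANY limit `ρ_b` of `schur_s(j_b, J)` as `s ↓ 0` has `|ρ_b| ≤ C` and
`|ρ_b − k| ≤ ε` at distance `≥ R` from both ends, and (U2) there is `C` bounding ANY limit of the contact pairings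
`schur_s(p_y², J)`, `y ∈ {0, N−1}`, uniformly in `N` — then `OrthogonalOhm` holds: the limits exist at every `N`
(`stub_G0PosDef` + `stub_fixedNLimits` + the proved route item `FeshbachIdentities`) and inherit the bounds. -/
theorem orthogonalOhm_of_uniformResponses :
    (∀ ω₂ lam β γ : ℝ, 0 < ω₂ → 0 < lam → 0 < β → 0 < γ → ∀ T : ℝ, 0 < T → ∃ k C : ℝ, ∀ ε : ℝ, 0 < ε → ∃ R : ℕ, ∀ N : ℕ, 2 ≤ N → let P := Literature.MathematicalPhysics.KineticTheory.HeatConduction.pinnedChain ω₂ lam β γ; let X := Literature.MathematicalPhysics.KineticTheory.HeatConduction.PhaseSpace N; let μ : MeasureTheory.Measure X := P.gibbsMeasure N T; let corr : (X → ℝ) → (X → ℝ) → ℝ → ℝ := fun f g t => (∫ z, f z * (∫ y, g y ∂(P.transitionKernel N T T t.toNNReal z)) ∂μ) - (∫ z, f z ∂μ) * (∫ z, g z ∂μ); let lap : ℝ → (X → ℝ) → (X → ℝ) → ℝ := fun s f g => ∫ t in Set.Ioi (0 : ℝ), Real.exp (-(s * t)) * corr f g t; let e : Fin N → X → ℝ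 := fun x z => z.2 x ^ 2 / 2 + P.U (z.1 x) + ∑ j : Fin N, ((if j.val = x.val + 1 then P.V (z.1 j - z.1 x) / 2 else 0) + (if x.val = j.val + 1 then P.V (z.1 x - z.1 j) / 2 else 0)); let G : ℝ → Matrix (Fin N) (Fin N) ℝ := fun s => Matrix.of fun x y => lap s (e x) (e y); let schur : ℝ → (X → ℝ) → (X → ℝ) → ℝ := fun s f g => lap s f g - ∑ x : Fin N, ∑ y : Fin N, lap s f (e x) * (G s)⁻¹ x y * lap s (e y) g; let J : X → ℝ := fun z => ∑ i : Fin N, P.bondCurrent N i z; ∀ b : Fin N, b.val + 1 < N → ∀ ρ : ℝ, Filter.Tendsto (fun s => schur s (P.bondCurrent N b) J) (nhdsWithin (0 : ℝ) (Set.Ioi 0)) (nhds ρ) → |ρ| ≤ C ∧ (R ≤ b.val → b.val + 2 + R ≤ N → |ρ - k| ≤ ε)) → (∀ ω₂ lam β γ : ℝ, 0 < ω₂ → 0 < lam → 0 < β → 0 < γ → ∀ T : ℝ, 0 < T → ∃ C : ℝ, ∀ N : ℕ, 2 ≤ N → let P := Literature.MathematicalPhysics.KineticTheory.HeatConduction.pinnedChain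 ω₂ lam β γ; let X := Literature.MathematicalPhysics.KineticTheory.HeatConduction.PhaseSpace N; let μ : MeasureTheory.Measure X := P.gibbsMeasure N T; let corr : (X → ℝ) → (X → ℝ) → ℝ → ℝ := fun f g t => (∫ z, f z * (∫ y, g y ∂(P.transitionKernel N T T t.toNNReal z)) ∂μ) - (∫ z, f z ∂μ) * (∫ z, g z ∂μ); let lap : ℝ → (X → ℝ) → (X → ℝ) → ℝ := fun s f g => ∫ t in Set.Ioi (0 : ℝ), Real.exp (-(s * t)) * corr f g t; let e : Fin N → X → ℝ := fun x z => z.2 x ^ 2 / 2 + P.U (z.1 x) + ∑ j : Fin N, ((if j.val = x.val + 1 then P.V (z.1 j - z.1 x) / 2 else 0) + (if x.val = j.val + 1 then P.V (z.1 x - z.1 j) / 2 else 0)); let G : ℝ → Matrix (Fin N) (Fin N) ℝ := fun s => Matrix.of fun x y => lap s (e x) (e y); let schur : ℝ → (X → ℝ) → (X → ℝ) → ℝ := fun s f g => lap s f g - ∑ x : Fin N, ∑ y : Fin N, lap s f (e x) * (G s)⁻¹ x y * lap s (e y) g; let J : X → ℝ := fun z => ∑ i : Fin N, P.bondCurrent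 N i z; ∀ b : Fin N, (b.val = 0 ∨ b.val = N - 1) → ∀ w : ℝ, Filter.Tendsto (fun s => schur s (fun z => z.2 b ^ 2) J) (nhdsWithin (0 : ℝ) (Set.Ioi 0)) (nhds w) → |w| ≤ C) → Summit.AtomisticToContinuum.FouriersLaw.Theses.HonestZwanzig.OrthogonalOhm := by
  intro hU1 hU2
  have h0 : Summit.AtomisticToContinuum.FouriersLaw.Theses.HonestZwanzig.FeshbachIdentities :=
    Robin.stub_feshbachIdentities  -- landed route item stmt-12697 (R0, p101386)
  have hF := stub_G0PosDef
  have hB := stub_fixedNLimits h0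
  intro ω₂ lam β γ hω hl hβ hγ T hT
  obtain ⟨k, C₁, hk⟩ := hU1 ω₂ lam β γ hω hl hβ hγ T hT
  obtain ⟨C₂, hC₂⟩ := hU2 ω₂ lam β γ hω hl hβ hγ T hT
  refine ⟨k, max C₁ C₂, fun ε hε => ?_⟩
  obtain ⟨R, hR⟩ := hk ε hε
  refine ⟨R, fun N hN => ?_⟩
  intro P X μ corr lap e G schur J
  -- the Feshbach package at this `N` (second conjunct: integrability / time reversal / Kolmogorov)
  obtain ⟨-, hFI2, -, -⟩ := h0 ω₂ lam β γ hω hl hβ hγ T hT N hN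
  -- symmetry of `G 0` (time reversal, even site energies) and positive definiteness (stub F) ⇒ invertible
  have hsymm : ∀ x y, G 0 x y = G 0 y x := fun x y =>
    pkg_G_symm (ω₂ := ω₂) (lam := lam) (β := β) (γ := γ) (N := N) (T := T)
      (Adm := fun f => Continuous f ∧ ∃ A : ℝ, ∀ z, |f z| ≤ A * Real.exp (P.hamiltonian N z / (8 * T)))
      (corr := corr) (lap := lap) (cov := fun f g => (∫ z, f z * g z ∂μ) - (∫ z, f z ∂μ) * (∫ z, g z ∂μ)) (e := e)
      (fun f => Iff.rfl) (fun s f g => rfl) (fun x z => rfl) hFI2 hω hl.le hβ.le hT 0 x y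
  have hpos : ∀ ξ : Fin N → ℝ, ξ ≠ 0 → 0 < ∑ x, ∑ y, ξ x * G 0 x y * ξ y :=
    hF ω₂ lam β γ hω hl hβ hγ T hT N hN
  have hPD : (G 0).PosDef := posDef_of_symm_of_pos (G 0) hsymm hpos
  have hdet : IsUnit (G 0).det := isUnit_iff_ne_zero.mpr hPD.det_pos.ne'
  -- existence of the limits at this `N` (stub B)
  have hlim := hB ω₂ lam β γ hω hl hβ hγ T hT N hN hdet
  have hAdmJ : Continuous J ∧ ∃ A : ℝ, ∀ z, |J z| ≤ A * Real.exp (P.hamiltonian N z / (8 * T)) :=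
    adm_totalCurrent (fun f => Continuous f ∧ ∃ A : ℝ, ∀ z, |f z| ≤ A * Real.exp (P.hamiltonian N z / (8 * T)))
      (fun f => Iff.rfl) hω hl.le hβ.le hT
  refine ⟨fun b hb => ?_, fun b hb => ?_⟩
  · -- bond clause
    have hAdmj : Continuous (P.bondCurrent N b) ∧
        ∃ A : ℝ, ∀ z, |P.bondCurrent N b z| ≤ A * Real.exp (P.hamiltonian N z / (8 * T)) :=
      adm_bondCurrent (fun f => Continuous f ∧ ∃ A : ℝ, ∀ z, |f z| ≤ A * Real.exp (P.hamiltonian N z / (8 * T)))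
        (fun f => Iff.rfl) hω hl.le hβ.le hT b
    have hρ : Tendsto (fun s => schur s (P.bondCurrent N b) J) (nhdsWithin (0 : ℝ) (Set.Ioi 0))
        (nhds (schur 0 (P.bondCurrent N b) J)) := hlim _ _ hAdmj hAdmJ
    obtain ⟨hC, hbulk⟩ := hR N hN b hb _ hρ
    exact ⟨schur 0 (P.bondCurrent N b) J, hρ, hC.trans (le_max_left _ _), hbulk⟩
  · -- contact clause
    have hAdmp : Continuous (fun z : X => z.2 b ^ 2) ∧
        ∃ A : ℝ, ∀ z : X, |z.2 b ^ 2| ≤ A * Real.exp (P.hamiltonian N z / (8 * T)) :=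
      adm_psq (fun f => Continuous f ∧ ∃ A : ℝ, ∀ z, |f z| ≤ A * Real.exp (P.hamiltonian N z / (8 * T)))
        (fun f => Iff.rfl) hω hl.le hβ.le hT b
    have hw : Tendsto (fun s => schur s (fun z => z.2 b ^ 2) J) (nhdsWithin (0 : ℝ) (Set.Ioi 0))
        (nhds (schur 0 (fun z => z.2 b ^ 2) J)) := hlim _ _ hAdmp hAdmJ
    exact ⟨schur 0 (fun z => z.2 b ^ 2) J, hw, (hC₂ N hN b hb _ hw).trans (le_max_right _ _)⟩


end Summit.AtomisticToContinuum.FouriersLaw.Theorems.HonestZwanzig
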